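import Summits.CriticalPhenomena.PercolationContinuityZ3.Theorems.PercNearOneGluingNoHeavyLowerTailKNGoodGMgcCert
import Summits.CriticalPhenomena.PercolationContinuityZ3.Theorems.PercNearOneGluingNoHeavyLowerTailSBTensKronDigits
import HarnessLib

/-!
# THEOREM B certificates — FAST evaluation of the trilinear checks by Kronecker packing
# (`NoHeavyLowerTail` cell, stmt-CriticalPhenomena-4575; prover `prim-hp-2`, gen 17)

Support file (`--supports stmt-CriticalPhenomena-4575`).  Computable definitions + soundness; no named facts, no sorries.
`KNGoodGMgc.checkTri j r ad` (`…KNGoodGMgcCert`) asks for all 4¹² scaled-Bernstein coefficients of the trilinear slack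
`G·u·v − X·v·w − Y·u·w` to be `≥ 0`; evaluating it by list convolution costs ≈ 2·10⁹ interpreted leaf operations.  `fastTri j r ad`
computes the SAME Boolean through `…SBTensKron`: the Kronecker encodings of the six degree-one factors (twelve-bit vertex functions),
nine big-integer products, the offset, and the recursive digit test — `checkTri_of_fastTri : fastTri j r ad = true → checkTri j r ad = true`
(leaf bounds `|G|,|X|,|Y| ≤ 2`, `u,v,w ∈ {0,1}` are part of the check; the a-priori bound on the slack's coefficients is `3·2²⁴ < 2³¹`, slot
width `32`).  Customers: `…KNGoodGMgcCertTri*` (`native_decide`, seconds per condition).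
-/

namespace Summit.CriticalPhenomena.PercolationContinuityZ3.Theorems

namespace KNGoodGMgc

open SBTens

/-- Slot width of the Kronecker packing (bits). [this work] -/
def BW : ℕ := 32

/-- The packed trilinear check: input leaf bounds + digit test of the packed slack. [this work] -/
def fastTri (j r : ℕ) (ad : Bool) : Bool :=
  let tG : Tens 12 := lift (ofFn 11 (facG j r ad))
  let tX : Tens 12 := lift (ofFn 11 (facX j r ad))
  let tY : Tens 12 := lift (ofFn 11 (facY j r))
  let tU : Tens 12 := ofFn 12 (qHat (facU j ad))
  let tV : Tens 12 := ofFn 12 (qHat (facV j))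
  let tW : Tens 12 := ofFn 12 (qHat (facW j ad))
  let eU := ienc BW 12 tU
  let eV := ienc BW 12 tV
  let eW := ienc BW 12 tW
  let N : ℤ := ienc BW 12 tG * (eU * eV) - ienc BW 12 tX * (eV * eW) - ienc BW 12 tY * (eU * eW) + off BW 12
  bndB 2 12 tG && (bndB 2 12 tX && (bndB 2 12 tY && (bndB 1 12 tU && (bndB 1 12 tV && (bndB 1 12 tW &&
    dec BW 12 N.toNat)))))

/-- Shape and leaf bound of a product `P · (Q · Q')` of a lifted eleven-bit factor with two twelve-bit factors. [this work] -/
theorem pqq_bnd (f g h : Cfg → ℤ) (RP : ℕ) (hf : bnd RP 12 (lift (ofFn 11 f))) (hg : bnd 1 12 (ofFn 12 g))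
    (hh : bnd 1 12 (ofFn 12 h)) :
    WF 12 (2 :: List.replicate 11 3) (mul 12 (lift (ofFn 11 f)) (mul 12 (ofFn 12 g) (ofFn 12 h))) ∧
      bnd (RP * 2 ^ 23) 12 (mul 12 (lift (ofFn 11 f)) (mul 12 (ofFn 12 g) (ofFn 12 h))) ∧
        ienc BW 12 (mul 12 (lift (ofFn 11 f)) (mul 12 (ofFn 12 g) (ofFn 12 h))) =
          ienc BW 12 (lift (ofFn 11 f)) * (ienc BW 12 (ofFn 12 g) * ienc BW 12 (ofFn 12 h)) := by
  have wq := WF_ofFn 12 g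
  have wq' := WF_ofFn 12 h
  have wp : WF 12 (0 :: List.replicate 11 1) (lift (ofFn 11 f)) := WF_lift 11 _ _ (WF_ofFn 11 f)
  have wqq : WF 12 (List.replicate 12 2) (mul 12 (ofFn 12 g) (ofFn 12 h)) := by
    simpa using (mul_spec 12 _ _ _ _ (by simp) (by simp) wq wq').1
  have bqq : bnd (2 ^ 12) 12 (mul 12 (ofFn 12 g) (ofFn 12 h)) := by
    have := bnd_mul 12 _ 1 1 _ _ wq hg hh
    have e : 1 * 1 * lenProd (List.replicate 12 1) = 2 ^ 12 := by decide
    rw [e] at this; exact this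
  refine ⟨?_, ?_, ?_⟩
  · simpa [List.replicate] using (mul_spec 12 _ _ _ _ (by simp) (by simp) wp wqq).1
  · have := bnd_mul 12 _ RP (2 ^ 12) _ _ wp hf bqq
    have e : RP * 2 ^ 12 * lenProd (0 :: List.replicate 11 1) = RP * 2 ^ 23 := by simp [lenProd]; ring
    rw [e] at this; exact this
  · rw [ienc_mul BW 12 _ _ _ _ (by simp) (by simp) wp wqq, ienc_mul BW 12 _ _ _ _ (by simp) (by simp) wq wq']

/-- **The packed check implies the convolution check.** [this work] -/
theorem checkTri_of_fastTri (j r : ℕ) (ad : Bool) (h : fastTri j r ad = true) : checkTri j r ad = true := by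
  simp only [fastTri, Bool.and_eq_true] at h
  obtain ⟨bG, bX, bY, bU, bV, bW, hdec⟩ := h
  obtain ⟨w1, b1, e1⟩ := pqq_bnd (facG j r ad) (qHat (facU j ad)) (qHat (facV j)) 2 bG bU bV
  obtain ⟨w2, b2, e2⟩ := pqq_bnd (facX j r ad) (qHat (facV j)) (qHat (facW j ad)) 2 bX bV bW
  obtain ⟨w3, b3, e3⟩ := pqq_bnd (facY j r) (qHat (facU j ad)) (qHat (facW j ad)) 2 bY bU bW
  have w12 := (sub_spec 12 _ _ _ w1 w2).1
  have b12 := bnd_sub 12 _ _ _ _ b1 b2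
  have wS : WF 12 (2 :: List.replicate 11 3) (slackTri j r ad) := (sub_spec 12 _ _ _ w12 w3).1
  have bS : bnd (2 * 2 ^ 23 + 2 * 2 ^ 23 + 2 * 2 ^ 23) 12 (slackTri j r ad) := bnd_sub 12 _ _ _ _ b12 b3
  have eS : ienc BW 12 (slackTri j r ad) =
      ienc BW 12 (lift (ofFn 11 (facG j r ad))) * (ienc BW 12 (ofFn 12 (qHat (facU j ad))) * ienc BW 12 (ofFn 12 (qHat (facV j))))
        - ienc BW 12 (lift (ofFn 11 (facX j r ad))) * (ienc BW 12 (ofFn 12 (qHat (facV j))) * ienc BW 12 (ofFn 12 (qHat (facW j ad))))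
        - ienc BW 12 (lift (ofFn 11 (facY j r))) * (ienc BW 12 (ofFn 12 (qHat (facU j ad))) * ienc BW 12 (ofFn 12 (qHat (facW j ad)))) := by
    rw [slackTri, ienc_sub BW 12 _ _ _ w12 w3, ienc_sub BW 12 _ _ _ w1 w2, e1, e2, e3]
  have hds : ∀ d ∈ (2 :: List.replicate 11 3 : List ℕ), d ≤ 3 := by decide
  have hR : ((2 * 2 ^ 23 + 2 * 2 ^ 23 + 2 * 2 ^ 23 : ℕ) : ℤ) + 1 ≤ 2 ^ (BW - 1) := by norm_num [BW]
  have hB : 1 ≤ BW := by norm_num [BW]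
  rw [← eS] at hdec
  exact dec_sound BW _ hB hR 12 _ (slackTri j r ad) wS hds bS hdec

end KNGoodGMgc

end Summit.CriticalPhenomena.PercolationContinuityZ3.Theorems
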